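import Summits.BirchSwinnertonDyer.BirchSwinnertonDyer.Theorems.GoldfeldAllTwistsTwoConverseTwinAdditiveInertTwistSelmer
import HarnessLib

set_option linter.dupNamespace false -- namespace `…BirchSwinnertonDyer.BirchSwinnertonDyer…` is the cell's (D-0017 nested layout)
set_option autoImplicit false

/-!
# Twin″ (item 19140), VIII: SPLIT primes — the `2`-isogeny Selmer sets of `49a1^{(−ℓ)}`,
# `ℓ ≡ 5 (mod 8)` prime SPLIT in `ℚ(√−7)`

Cell `bsd-goldfeld`, seat `bsd-goldfeld-s1p-c301` (gen 2); `--supports stmt-BirchSwinnertonDyer-19140`.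
Companion of parts I/V (inert primes). For a prime `ℓ ≡ 5 (mod 8)` with `(−7/ℓ) = +1` (`ℓ = 37, 53, 109,
149, …`) the Selmer sets of `E_{−ℓ} : y² = x³ − 21ℓ x² + 112ℓ² x` vary (`S = {1,7,2ℓ,14ℓ}` for `ℓ = 37`,
`{1,7,ℓ,7ℓ}` for `ℓ = 53`), but their ORDERS are `≤ 4` and `≤ 2`:
* `not_isSoluble_padic_of_nonresidue_of_sq_dvd` — odd `p`, `p ∤ d`, `a = pc`, `d' = p²e'`, `d` and `e'`
  non-residues ⇒ no `ℚ_p`-point; at `p = ℓ` it kills `d = 2` (`e' = 56`) and `d = 14` (`e' = 8`), since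
  `(2/ℓ) = −1` (`ℓ ≡ 5 (mod 8)`) and `(7/ℓ) = (ℓ/7) = +1`.
* `not_isSoluble_two_splitPrime` — for `ℓ ≡ 5 (mod 8)`, `w² = ℓu⁴ + 42ℓu²z² − 7ℓz⁴` has no `ℚ₂`-point
  (modulo `32` in a `ℤ₂`-chart; `decide` in `ℤ/32`).
* `card_twoIsogenySelmerGroup_splitPrimeTwist_le`: **`#S(−21ℓ, 112ℓ²) ≤ 4`** (`S ⊆ {1,7,ℓ,2ℓ,7ℓ,14ℓ}`,
  and `#S` is a power of `2`: Silverman X.4.9, tree `exists_card_twoIsogenySelmerGroup_eq_two_pow`).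
* `card_twoIsogenySelmerGroup'_splitPrimeTwist_le`: **`#S(42ℓ, −7ℓ²) ≤ 2`** (`−1, 7, −ℓ, 7ℓ` die at
  `7` — `ℓ` is a square mod `7` by reciprocity, `−1` is not, `7 ∥ 1792ℓ²`; `ℓ` dies at `2`; so
  `S' ⊆ {1, −7, −7ℓ}` and `#S'` is a power of `2`).
Numerically (gen-0 kit tables): all `57` such `ℓ ≤ 3000` give twists of analytic rank `1`; `56` resolved,
all with `Ш[2] = 0`, `#Ш_an = 1`. For split `ℓ ≡ 1 (mod 8)` this fails to be uniform (`6` of `40`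
resolved twists have `Ш[2] ≅ (ℤ/2)²`), so `ℓ ≡ 5 (mod 8)` is sharp. HONEST FRAMING: no `BSD(W,2)` is
proved; BSD is not proved by any of this.

References: Silverman, *AEC* (2009), X.4.9–X.4.10 [SilvermanAEC2009]; Zywina, arXiv:2502.01957, Lemma 3.1 [Zywina2025].
-/

noncomputable section

open scoped Classical

open WeierstrassCurve Literature.NumberTheory.EllipticCurves
open Literature.NumberTheory.EllipticCurves.Zywina2025 (exists_padicInt_of_isSoluble
  isSquare_zmod_of_isSoluble_padic)

namespace Summit.BirchSwinnertonDyer.BirchSwinnertonDyer.Theorems.GoldfeldGoodTwists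

/-! ## §1. Local lemmas -/

/-- In `ℤ_p`: `x mod p = 0 ↔ p ∣ x`. [folklore] -/
private theorem toZMod_eq_zero_iff_dvd' {p : ℕ} [Fact p.Prime] (x : ℤ_[p]) :
    PadicInt.toZMod x = 0 ↔ (p : ℤ_[p]) ∣ x := by
  rw [← RingHom.mem_ker, PadicInt.ker_toZMod, PadicInt.maximalIdeal_eq_span_p,
    Ideal.mem_span_singleton]

/-- Chart `z = 1`: `s² = d + p c t² + p² e' t⁴` forces `d` to be a square mod `p`. [folklore] -/
private theorem isSquare_of_sq_eq_chart_one {p : ℕ} [Fact p.Prime] {d c e' : ℤ} {t s : ℤ_[p]}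
    (h : s ^ 2 = (d : ℤ_[p]) + (p : ℤ_[p]) * c * t ^ 2 + (p : ℤ_[p]) ^ 2 * e' * t ^ 4) :
    IsSquare ((d : ℤ) : ZMod p) := by
  have h0 := congrArg PadicInt.toZMod h
  simp only [map_pow, map_add, map_mul, map_intCast, map_natCast, ZMod.natCast_self, zero_mul,
    add_zero, zero_pow two_ne_zero] at h0
  exact ⟨PadicInt.toZMod s, by rw [← pow_two, h0]⟩

/-- Chart `u = 1`: `s² = p² e' + p c t² + d t⁴` forces `d` or `e'` to be a square mod `p`. [folklore] -/
private theorem isSquare_or_of_sq_eq_chart_two {p : ℕ} [Fact p.Prime] {d c e' : ℤ} {t s : ℤ_[p]}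
    (h : s ^ 2 = (p : ℤ_[p]) ^ 2 * e' + (p : ℤ_[p]) * c * t ^ 2 + (d : ℤ_[p]) * t ^ 4) :
    IsSquare ((d : ℤ) : ZMod p) ∨ IsSquare ((e' : ℤ) : ZMod p) := by
  have hpp : Prime (p : ℤ_[p]) := PadicInt.prime_p
  by_cases ht : (p : ℤ_[p]) ∣ t
  · right
    obtain ⟨t₁, rfl⟩ := ht
    have hs2 : (p : ℤ_[p]) ^ 2 ∣ s ^ 2 :=
      ⟨e' + (p : ℤ_[p]) * c * t₁ ^ 2 + (p : ℤ_[p]) ^ 2 * d * t₁ ^ 4, by rw [h]; ring⟩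
    have hs : (p : ℤ_[p]) ∣ s := hpp.dvd_of_dvd_pow (dvd_trans (dvd_pow_self _ two_ne_zero) hs2)
    obtain ⟨s₁, rfl⟩ := hs
    have h1 : s₁ ^ 2 = (e' : ℤ_[p]) + (p : ℤ_[p]) * c * t₁ ^ 2 + (p : ℤ_[p]) ^ 2 * d * t₁ ^ 4 :=
      mul_left_cancel₀ (pow_ne_zero 2 hpp.ne_zero) (by rw [← mul_pow, h]; ring)
    exact isSquare_of_sq_eq_chart_one h1
  · left
    have h0 := congrArg PadicInt.toZMod h
    simp only [map_pow, map_add, map_mul, map_intCast, map_natCast, ZMod.natCast_self, zero_mul,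
      zero_add, zero_pow two_ne_zero] at h0
    have hT : PadicInt.toZMod t ≠ 0 := by rwa [Ne, toZMod_eq_zero_iff_dvd']
    refine ⟨PadicInt.toZMod s / PadicInt.toZMod t ^ 2, ?_⟩
    have hT4 : PadicInt.toZMod t ^ 4 ≠ 0 := pow_ne_zero 4 hT
    rw [show PadicInt.toZMod s / PadicInt.toZMod t ^ 2 * (PadicInt.toZMod s / PadicInt.toZMod t ^ 2) =
        PadicInt.toZMod s ^ 2 / PadicInt.toZMod t ^ 4 by ring, h0, mul_div_assoc, div_self hT4, mul_one]

/-- **Local lemma at an odd prime `p` with `p ∤ d`, `p ∣ a`, `p² ∣ d'`.** If `a = p c`, `d' = p² e'`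
and both `d` and `e'` are non-residues mod `p`, then `w² = d u⁴ + a u²z² + d' z⁴` has no non-trivial
`ℚ_p`-point (chart `z = 1`: `d` would be a square; chart `u = 1`: `d` would be a square unless `p ∣ t`,
and then `e'` would be). Used at `p = ℓ` for the classes `2` (`e' = 56`) and `14` (`e' = 8`).
[cite: SilvermanAEC2009, Prop. X.4.9 and Example X.4.10] -/
theorem not_isSoluble_padic_of_nonresidue_of_sq_dvd {p : ℕ} [Fact p.Prime] {a d d' c e' : ℤ}
    (ha : a = p * c) (hd' : d' = (p : ℤ) ^ 2 * e') (hd : ¬ IsSquare ((d : ℤ) : ZMod p))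
    (he' : ¬ IsSquare ((e' : ℤ) : ZMod p)) :
    ¬ ((twoIsogenyQuartic a d d').map (Int.castRingHom ℚ_[p])).IsSoluble := by
  intro h
  obtain ⟨f, f', hff, t, s, hs⟩ := exists_padicInt_of_isSoluble h
  rcases hff with ⟨hf, hf'⟩ | ⟨hf, hf'⟩
  · rw [hf, hf'] at hs
    exact hd (isSquare_of_sq_eq_chart_one (c := c) (e' := e') (t := t) (s := s)
      (by rw [hs, ha, hd']; push_cast; ring))
  · rw [hf, hf'] at hs
    rcases isSquare_or_of_sq_eq_chart_two (d := d) (c := c) (e' := e') (t := t) (s := s)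
        (by rw [hs, ha, hd']; push_cast; ring) with h1 | h1
    · exact hd h1
    · exact he' h1

/-- The finite check behind the `2`-adic lemma: for `x ≡ 5 (mod 8)` in `ℤ/32`, neither
`x(1 + 42T² − 7T⁴)` nor `x(−7 + 42T² + T⁴)` is a square. [folklore] -/
private theorem zmod_thirtytwo_key : ∀ x : ZMod 32, (x = 5 ∨ x = 13 ∨ x = 21 ∨ x = 29) →
    ∀ T S : ZMod 32, S ^ 2 ≠ x * (1 + 42 * T ^ 2 - 7 * T ^ 4) ∧
      S ^ 2 ≠ x * (-7 + 42 * T ^ 2 + T ^ 4) := by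
  decide

/-- `ℓ ≡ 5 (mod 8)` ⇒ `ℓ mod 32 ∈ {5, 13, 21, 29}`, in `ℤ/32`. [folklore] -/
private theorem zmod_thirtytwo_of_mod_eight {l : ℕ} (hl8 : l % 8 = 5) :
    (l : ZMod 32) = 5 ∨ (l : ZMod 32) = 13 ∨ (l : ZMod 32) = 21 ∨ (l : ZMod 32) = 29 := by
  have h : l % 32 = 5 ∨ l % 32 = 13 ∨ l % 32 = 21 ∨ l % 32 = 29 := by omega
  rw [← ZMod.natCast_mod l 32]
  rcases h with h | h | h | h <;> rw [h] <;> norm_num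

/-- **`2`-adic lemma for the split family.** For `ℓ ≡ 5 (mod 8)` the homogeneous space
`w² = ℓ u⁴ + 42ℓ u²z² − 7ℓ z⁴` (the class `d = ℓ` of `S(42ℓ, −7ℓ²)`) has no non-trivial `ℚ₂`-point:
in either `ℤ₂`-chart the equation, read modulo `32`, is excluded by `zmod_thirtytwo_key`.
[cite: SilvermanAEC2009, Prop. X.4.9 and Example X.4.10] -/
theorem not_isSoluble_two_splitPrime {l : ℕ} (hl8 : l % 8 = 5) :
    ¬ ((twoIsogenyQuartic (42 * l) l (-7 * l)).map (Int.castRingHom ℚ_[2])).IsSoluble := by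
  haveI : Fact (Nat.Prime 2) := ⟨Nat.prime_two⟩
  intro h
  obtain ⟨f, f', hff, t, s, hs⟩ := exists_padicInt_of_isSoluble h
  have hx := zmod_thirtytwo_of_mod_eight hl8
  rcases hff with ⟨rfl, rfl⟩ | ⟨rfl, rfl⟩
  · have h2 := congrArg (PadicInt.toZModPow 5 : ℤ_[2] →+* ZMod (2 ^ 5)) hs
    simp only [map_pow, map_add, map_mul, map_intCast] at h2
    push_cast at h2
    exact (zmod_thirtytwo_key (l : ZMod 32) hx (PadicInt.toZModPow 5 t) (PadicInt.toZModPow 5 s)).1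
      (by rw [h2]; ring)
  · have h2 := congrArg (PadicInt.toZModPow 5 : ℤ_[2] →+* ZMod (2 ^ 5)) hs
    simp only [map_pow, map_add, map_mul, map_intCast] at h2
    push_cast at h2
    exact (zmod_thirtytwo_key (l : ZMod 32) hx (PadicInt.toZModPow 5 t) (PadicInt.toZModPow 5 s)).2
      (by rw [h2]; ring)

/-! ## §2. Number-theoretic inputs for a split prime `ℓ ≡ 5 (mod 8)` -/

/-- For `ℓ ≡ 1 (mod 4)` with `(−7/ℓ) = 1`: `(7/ℓ) = 1`. [folklore] -/
private theorem legendreSym_seven_eq_one {l : ℕ} [Fact l.Prime] (hl4 : l % 4 = 1)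
    (hl7 : legendreSym l (-7) = 1) : legendreSym l 7 = 1 := by
  have hl2 : l ≠ 2 := by rintro rfl; norm_num at hl4
  have h1 : legendreSym l (-1) = 1 := by
    rw [legendreSym.at_neg_one hl2, ZMod.χ₄_nat_one_mod_four hl4]
  have hmul : legendreSym l (-7) = legendreSym l (-1) * legendreSym l 7 := by
    rw [← legendreSym.mul]; norm_num
  rwa [hmul, h1, one_mul] at hl7

/-- For `ℓ ≡ 5 (mod 8)`: `2` is a non-residue. [folklore] -/
private theorem not_isSquare_two_of_mod_eight {l : ℕ} [Fact l.Prime] (hl8 : l % 8 = 5) :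
    ¬ IsSquare ((2 : ℤ) : ZMod l) := by
  have hl2 : l ≠ 2 := by rintro rfl; norm_num at hl8
  refine (legendreSym.eq_neg_one_iff l).mp ?_
  rw [legendreSym.at_two hl2, ZMod.χ₈_nat_eq_if_mod_eight]
  simp [hl8, show l % 2 = 1 by omega]

/-- For `ℓ ≡ 5 (mod 8)` split: `14`, `8` and `56` are non-residues mod `ℓ`. [folklore] -/
private theorem not_isSquare_fourteen_eight_fiftysix {l : ℕ} [Fact l.Prime] (hl8 : l % 8 = 5)
    (hl7 : legendreSym l (-7) = 1) :
    ¬ IsSquare ((14 : ℤ) : ZMod l) ∧ ¬ IsSquare ((8 : ℤ) : ZMod l) ∧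
      ¬ IsSquare ((56 : ℤ) : ZMod l) := by
  have hl2 : l ≠ 2 := by rintro rfl; norm_num at hl8
  have h2 : legendreSym l 2 = -1 := (legendreSym.eq_neg_one_iff l).mpr (not_isSquare_two_of_mod_eight hl8)
  have h7 : legendreSym l 7 = 1 := legendreSym_seven_eq_one (by omega) hl7
  have h20 : ((2 : ℤ) : ZMod l) ≠ 0 := by
    intro h
    have : ((2 : ℕ) : ZMod l) = 0 := by exact_mod_cast h
    rw [ZMod.natCast_eq_zero_iff] at this
    exact hl2 ((Nat.prime_dvd_prime_iff_eq Fact.out Nat.prime_two).mp this)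
  have h4 : legendreSym l 4 = 1 := by
    rw [show (4 : ℤ) = 2 ^ 2 by norm_num]; exact legendreSym.sq_one' l h20
  refine ⟨(legendreSym.eq_neg_one_iff l).mp ?_, (legendreSym.eq_neg_one_iff l).mp ?_,
    (legendreSym.eq_neg_one_iff l).mp ?_⟩
  · rw [show (14 : ℤ) = 2 * 7 by norm_num, legendreSym.mul, h2, h7]; norm_num
  · rw [show (8 : ℤ) = 4 * 2 by norm_num, legendreSym.mul, h4, h2]; norm_num
  · rw [show (56 : ℤ) = 4 * (2 * 7) by norm_num, legendreSym.mul, legendreSym.mul, h4, h2, h7]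
    norm_num

/-- `ℓ` split, `ℓ ≡ 1 (mod 4)`, `ℓ ≠ 7`: `ℓ` is a nonzero square mod `7`, so `−ℓ` is not. [folklore] -/
private theorem zmod_seven_neg_l_nonresidue {l : ℕ} [Fact l.Prime] (hl4 : l % 4 = 1)
    (hl7 : legendreSym l (-7) = 1) (hl7' : l ≠ 7) :
    ((l : ℤ) : ZMod 7) ≠ 0 ∧ ∀ r : ZMod 7, r * r ≠ -(l : ZMod 7) := by
  haveI : Fact (Nat.Prime 7) := ⟨by norm_num⟩
  have hl07 : ((l : ℤ) : ZMod 7) ≠ 0 := by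
    rw [Ne, ZMod.intCast_zmod_eq_zero_iff_dvd]
    intro h
    exact hl7' ((Nat.prime_dvd_prime_iff_eq (by norm_num) Fact.out).mp (by exact_mod_cast h)).symm
  refine ⟨hl07, ?_⟩
  have h7l : legendreSym 7 l = 1 := by
    rw [legendreSym.quadratic_reciprocity_one_mod_four hl4 (by norm_num)]
    exact_mod_cast legendreSym_seven_eq_one hl4 hl7
  obtain ⟨q, hq⟩ := (legendreSym.eq_one_iff 7 hl07).mp h7l
  push_cast at hq hl07
  intro r hr
  -- `-1 = (r / q)²`, but `-1` is a non-residue mod 7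
  have hq0 : q ≠ 0 := by rintro rfl; apply hl07; rw [hq]; ring
  apply zmod_seven_nonresidues_neg_one_neg_sq.1 (r / q)
  rw [div_mul_div_comm, hr, hq, neg_div, div_self (mul_ne_zero hq0 hq0)]

/-! ## §3. The Selmer sets of `E_{−ℓ}` for a split prime `ℓ ≡ 5 (mod 8)`: orders `≤ 4` and `≤ 2` -/

/-- **`#S(−21ℓ, 112ℓ²) ≤ 4`** for a prime `ℓ ≡ 5 (mod 8)` with `(−7/ℓ) = 1`: `S` is contained in the six
positive divisors `{1, 7, ℓ, 2ℓ, 7ℓ, 14ℓ}` of `14ℓ` (the real place kills `d < 0`; the prime `ℓ` kills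
`2` and `14` by `not_isSoluble_padic_of_nonresidue_of_sq_dvd`), and `#S` is a power of `2`
(Silverman X.4.9). [cite: SilvermanAEC2009, Prop. X.4.9 and Example X.4.10] -/
theorem card_twoIsogenySelmerGroup_splitPrimeTwist_le {l : ℕ} [Fact l.Prime] (hl8 : l % 8 = 5)
    (hl7 : legendreSym l (-7) = 1) :
    (twoIsogenySelmerGroup (-21 * l) (112 * l ^ 2)).card ≤ 4 := by
  have hl : l.Prime := Fact.out
  have hlp : Prime (l : ℤ) := Nat.prime_iff_prime_int.mp hl
  have hl0 : (l : ℤ) ≠ 0 := by exact_mod_cast hl.ne_zero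
  have hlpos : (0 : ℤ) < l := by exact_mod_cast hl.pos
  have hb : (112 * l ^ 2 : ℤ) ≠ 0 := by positivity
  obtain ⟨h14, h8, h56⟩ := not_isSquare_fourteen_eight_fiftysix hl8 hl7
  have h2 := not_isSquare_two_of_mod_eight hl8
  -- `S ⊆ {1, 7, ℓ, 2ℓ, 7ℓ, 14ℓ}`
  have hsub : twoIsogenySelmerGroup (-21 * l) (112 * l ^ 2) ⊆
      ({1, 7, (l : ℤ) * 1, (l : ℤ) * 2, (l : ℤ) * 7, (l : ℤ) * 14} : Finset ℤ) := by
    intro d hd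
    rw [mem_twoIsogenySelmerGroup_iff hb] at hd
    obtain ⟨hsqf, ⟨d', hdd'⟩, hloc⟩ := hd
    have hd'eq : (112 * l ^ 2 : ℤ) / d = d' := by
      rw [hdd', Int.mul_ediv_cancel_left _ hsqf.ne_zero]
    rw [hd'eq] at hloc
    obtain ⟨hreal, hpadic⟩ := hloc
    have hdpos : 0 < d := by
      rcases lt_or_gt_of_ne hsqf.ne_zero with hneg | hpos
      · exfalso
        have hbpos : (0 : ℤ) < 112 * (l : ℤ) ^ 2 := by positivity
        have hd'neg : d' < 0 := by
          by_contra hcon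
          nlinarith [mul_nonpos_iff.mpr (Or.inr ⟨hneg.le, le_of_not_gt hcon⟩)]
        exact not_isSoluble_real_twoIsogenyQuartic_of_neg hneg hd'neg (by linarith) hreal
      · exact hpos
    -- `d ≠ 2, 14`
    have hne2 : d ≠ 2 := by
      rintro rfl
      have hd'1 : d' = (l : ℤ) ^ 2 * 56 := by linarith
      exact not_isSoluble_padic_of_nonresidue_of_sq_dvd (p := l) (c := -21) (e' := 56) (by ring)
        hd'1 h2 h56 (hpadic l)
    have hne14 : d ≠ 14 := by
      rintro rfl
      have hd'1 : d' = (l : ℤ) ^ 2 * 8 := by linarith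
      exact not_isSoluble_padic_of_nonresidue_of_sq_dvd (p := l) (c := -21) (e' := 8) (by ring)
        hd'1 h14 h8 (hpadic l)
    -- `d ∣ 14ℓ`
    have h0 : d ∣ 112 * (l : ℤ) ^ 2 := ⟨d', hdd'⟩
    have h1 : d ∣ (14 * (l : ℤ)) ^ 4 := h0.trans ⟨343 * (l : ℤ) ^ 2, by ring⟩
    have h14l : d ∣ 14 * (l : ℤ) := (hsqf.dvd_pow_iff_dvd (by norm_num)).mp h1
    by_cases hld : (l : ℤ) ∣ d
    · obtain ⟨e, rfl⟩ := hld
      have he14 : e ∣ 14 := by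
        have : (l : ℤ) * e ∣ (l : ℤ) * 14 := by rw [mul_comm (l : ℤ) 14]; exact h14l
        exact (mul_dvd_mul_iff_left hl0).mp this
      have hepos : 0 < e := pos_of_mul_pos_right hdpos hlpos.le
      have hele : e ≤ 14 := Int.le_of_dvd (by norm_num) he14
      interval_cases e <;> first | (exfalso; omega) | simp
    · have hcop : IsCoprime d (l : ℤ) := ((hlp.irreducible.coprime_iff_not_dvd).mpr hld).symm
      have hd14 : d ∣ 14 := hcop.dvd_of_dvd_mul_right h14l
      have hle : d ≤ 14 := Int.le_of_dvd (by norm_num) hd14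
      interval_cases d <;> first | (exfalso; omega) | simp
  have hab : (112 * l ^ 2 : ℤ) * ((-21 * l) ^ 2 - 4 * (112 * l ^ 2)) ≠ 0 := by
    rw [show ((-21 * l : ℤ) ^ 2 - 4 * (112 * l ^ 2)) = -7 * l ^ 2 by ring]
    exact mul_ne_zero hb (mul_ne_zero (by norm_num) (pow_ne_zero 2 hl0))
  obtain ⟨k, hk⟩ := exists_card_twoIsogenySelmerGroup_eq_two_pow hab
  have hle6 : (twoIsogenySelmerGroup (-21 * l) (112 * l ^ 2)).card ≤ 6 :=
    (Finset.card_le_card hsub).trans Finset.card_le_six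
  rw [hk] at hle6 ⊢
  have hk2 : k < 3 := (Nat.pow_lt_pow_iff_right one_lt_two).mp (lt_of_le_of_lt hle6 (by norm_num))
  calc 2 ^ k ≤ 2 ^ 2 := Nat.pow_le_pow_right two_pos (by omega)
    _ = 4 := by norm_num

/-- **`#S'(−21ℓ, 112ℓ²) = #S(42ℓ, −7ℓ²) ≤ 2`** for a prime `ℓ ≡ 5 (mod 8)` with `(−7/ℓ) = 1`:
`S' ⊆ ±{1, 7, ℓ, 7ℓ}`; the classes `−1, 7, −ℓ, 7ℓ` have no `ℚ_7`-point (`7 ∥ 1792ℓ²`; `−1` and `−ℓ` are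
non-residues mod `7`, `ℓ` being a square there by reciprocity), the class `ℓ` has no `ℚ₂`-point
(`not_isSoluble_two_splitPrime`); so `S' ⊆ {1, −7, −7ℓ}` and `#S'` is a power of `2`.
[cite: SilvermanAEC2009, Prop. X.4.9] [cite: Zywina2025, Lemma 3.1 (proof)] -/
theorem card_twoIsogenySelmerGroup'_splitPrimeTwist_le {l : ℕ} [Fact l.Prime] (hl8 : l % 8 = 5)
    (hl7 : legendreSym l (-7) = 1) :
    (twoIsogenySelmerGroup' (-21 * l) (112 * l ^ 2)).card ≤ 2 := by
  have hl : l.Prime := Fact.out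
  haveI : Fact (Nat.Prime 7) := ⟨by norm_num⟩
  have hlp : Prime (l : ℤ) := Nat.prime_iff_prime_int.mp hl
  have hl0 : (l : ℤ) ≠ 0 := by exact_mod_cast hl.ne_zero
  have hl4 : l % 4 = 1 := by omega
  have hl7' : l ≠ 7 := by rintro rfl; norm_num at hl8
  obtain ⟨hl07, hnegl⟩ := zmod_seven_neg_l_nonresidue hl4 hl7 hl7'
  have hm1 : ∀ r : ZMod 7, r * r ≠ -1 := zmod_seven_nonresidues_neg_one_neg_sq.1
  have hA : (-2 * (-21 * l : ℤ)) = 42 * l := by ring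
  have hB : ((-21 * l : ℤ) ^ 2 - 4 * (112 * l ^ 2)) = -7 * l ^ 2 := by ring
  have hb : (-7 * l ^ 2 : ℤ) ≠ 0 := mul_ne_zero (by norm_num) (pow_ne_zero 2 hl0)
  have hsub : twoIsogenySelmerGroup' (-21 * l) (112 * l ^ 2) ⊆ ({1, -7, (l : ℤ) * (-7)} : Finset ℤ) := by
    intro d hd
    rw [twoIsogenySelmerGroup'_eq, hA, hB, mem_twoIsogenySelmerGroup_iff hb] at hd
    obtain ⟨hsqf, ⟨d', hdd'⟩, hloc⟩ := hd
    have hd'eq : (-7 * l ^ 2 : ℤ) / d = d' := by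
      rw [hdd', Int.mul_ediv_cancel_left _ hsqf.ne_zero]
    rw [hd'eq] at hloc
    obtain ⟨-, hpadic⟩ := hloc
    have hdisc : ∀ x y : ℤ, x * y = -7 * (l : ℤ) ^ 2 →
        (7 : ℤ) ∣ (42 * (l : ℤ)) ^ 2 - 4 * x * y ∧ ¬ (7 : ℤ) ^ 2 ∣ (42 * (l : ℤ)) ^ 2 - 4 * x * y := by
      intro x y hxy
      have e1 : (42 * (l : ℤ)) ^ 2 - 4 * x * y = 1792 * (l : ℤ) ^ 2 := by rw [mul_assoc, hxy]; ring
      rw [e1]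
      refine ⟨⟨256 * (l : ℤ) ^ 2, by ring⟩, not_sq_seven_dvd_of_not_dvd fun h => hl7' ?_⟩
      exact ((Nat.prime_dvd_prime_iff_eq (by norm_num) hl).mp h).symm
    -- the four classes killed at `7`
    have hm1' : d ≠ -1 := by
      rintro rfl
      obtain ⟨hB1, hB2⟩ := hdisc (-1) d' hdd'.symm
      obtain ⟨-, r, hr⟩ := isSquare_zmod_of_isSoluble_padic (p := 7) (by norm_num) (by decide) hB1 hB2
        (hpadic 7)
      push_cast at hr
      exact hm1 r hr.symm
    have hml : d ≠ -(l : ℤ) := by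
      rintro rfl
      obtain ⟨hB1, hB2⟩ := hdisc (-(l : ℤ)) d' hdd'.symm
      have hnd : ¬ (7 : ℤ) ∣ -(l : ℤ) := fun h =>
        hl07 ((ZMod.intCast_zmod_eq_zero_iff_dvd _ 7).mpr ((Int.dvd_neg).mp h))
      obtain ⟨-, r, hr⟩ := isSquare_zmod_of_isSoluble_padic (p := 7) (by norm_num) hnd hB1 hB2 (hpadic 7)
      push_cast at hr
      exact hnegl r hr.symm
    have hp7 : d ≠ 7 := by
      rintro rfl
      have hd'1 : d' = -(l : ℤ) ^ 2 := by linarith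
      subst hd'1
      have hsol := (isSoluble_map_twoIsogenyQuartic_comm (Int.castRingHom ℚ_[7]) (42 * (l : ℤ)) 7
        (-(l : ℤ) ^ 2)).mp (hpadic 7)
      have hnd : ¬ (7 : ℤ) ∣ -(l : ℤ) ^ 2 := by
        intro h
        have h7p : Prime (7 : ℤ) := Int.prime_iff_natAbs_prime.mpr (by norm_num)
        exact hl07 ((ZMod.intCast_zmod_eq_zero_iff_dvd _ 7).mpr (h7p.dvd_of_dvd_pow ((Int.dvd_neg).mp h)))
      obtain ⟨hB1, hB2⟩ := hdisc (-(l : ℤ) ^ 2) 7 (by ring)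
      obtain ⟨-, r, hr⟩ := isSquare_zmod_of_isSoluble_padic (p := 7) (by norm_num) hnd hB1 hB2 hsol
      push_cast at hr hl07
      -- `-(l²) = r²` ⇒ `-1 = (r/l)²`
      apply hm1 (r / (l : ZMod 7))
      rw [div_mul_div_comm, ← hr, pow_two, neg_div, div_self (mul_ne_zero hl07 hl07)]
    have hp7l : d ≠ 7 * l := by
      rintro rfl
      have hd'1 : d' = -(l : ℤ) := mul_left_cancel₀ (show (7 * (l : ℤ)) ≠ 0 by positivity)
        (by linear_combination (-1 : ℤ) * hdd')
      subst hd'1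
      have hsol := (isSoluble_map_twoIsogenyQuartic_comm (Int.castRingHom ℚ_[7]) (42 * (l : ℤ))
        (7 * (l : ℤ)) (-(l : ℤ))).mp (hpadic 7)
      have hnd : ¬ (7 : ℤ) ∣ -(l : ℤ) := fun h =>
        hl07 ((ZMod.intCast_zmod_eq_zero_iff_dvd _ 7).mpr ((Int.dvd_neg).mp h))
      obtain ⟨hB1, hB2⟩ := hdisc (-(l : ℤ)) (7 * l) (by ring)
      obtain ⟨-, r, hr⟩ := isSquare_zmod_of_isSoluble_padic (p := 7) (by norm_num) hnd hB1 hB2 hsol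
      push_cast at hr
      exact hnegl r hr.symm
    -- the class `ℓ` killed at `2`
    have hpl : d ≠ (l : ℤ) := by
      rintro rfl
      have hd'1 : d' = -7 * (l : ℤ) := mul_left_cancel₀ hl0 (by linear_combination (-1 : ℤ) * hdd')
      subst hd'1
      exact not_isSoluble_two_splitPrime hl8 (hpadic 2)
    -- `d ∣ 7ℓ`
    have h0 : d ∣ -7 * (l : ℤ) ^ 2 := ⟨d', hdd'⟩
    have h1 : d ∣ (7 * (l : ℤ)) ^ 2 := h0.trans ⟨-7, by ring⟩
    have h7l : d ∣ 7 * (l : ℤ) := (hsqf.dvd_pow_iff_dvd (by norm_num)).mp h1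
    by_cases hld : (l : ℤ) ∣ d
    · obtain ⟨e, rfl⟩ := hld
      have he7 : e ∣ 7 := by
        have : (l : ℤ) * e ∣ (l : ℤ) * 7 := by rw [mul_comm (l : ℤ) 7]; exact h7l
        exact (mul_dvd_mul_iff_left hl0).mp this
      have hele : e ≤ 7 := Int.le_of_dvd (by norm_num) he7
      have hege : -7 ≤ e := by
        have := Int.le_of_dvd (by norm_num) ((Int.neg_dvd).mpr he7); linarith
      have hne1 : e ≠ 1 := by rintro rfl; exact hpl (by ring)
      have hnem1 : e ≠ -1 := by rintro rfl; exact hml (by ring)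
      have hne7 : e ≠ 7 := by rintro rfl; exact hp7l (by ring)
      obtain ⟨k, hk⟩ := he7
      interval_cases e <;> first | (exfalso; omega) | simp
    · have hcop : IsCoprime d (l : ℤ) := ((hlp.irreducible.coprime_iff_not_dvd).mpr hld).symm
      have hd7 : d ∣ 7 := hcop.dvd_of_dvd_mul_right h7l
      have hle : d ≤ 7 := Int.le_of_dvd (by norm_num) hd7
      have hge : -7 ≤ d := by
        have := Int.le_of_dvd (by norm_num) ((Int.neg_dvd).mpr hd7); linarith
      obtain ⟨k, hk⟩ := hd7
      interval_cases d <;> first | (exfalso; omega) | simp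
  have hab : (112 * l ^ 2 : ℤ) * ((-21 * l) ^ 2 - 4 * (112 * l ^ 2)) ≠ 0 := by
    rw [hB]; exact mul_ne_zero (by positivity) hb
  obtain ⟨k, hk⟩ := exists_card_twoIsogenySelmerGroup'_eq_two_pow hab
  have hle3 : (twoIsogenySelmerGroup' (-21 * l) (112 * l ^ 2)).card ≤ 3 :=
    (Finset.card_le_card hsub).trans Finset.card_le_three
  rw [hk] at hle3 ⊢
  have hk2 : k < 2 := (Nat.pow_lt_pow_iff_right one_lt_two).mp (lt_of_le_of_lt hle3 (by norm_num))
  calc 2 ^ k ≤ 2 ^ 1 := Nat.pow_le_pow_right two_pos (by omega)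
    _ = 2 := by norm_num

end Summit.BirchSwinnertonDyer.BirchSwinnertonDyer.Theorems.GoldfeldGoodTwists

end
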